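import Literature.MeasureTheory.Group.InvariantQuotientNormalized        -- ★ `quotientMeasure`, Weil `lintegral_fiberLIntegral_quotientMeasure`; brings ★ `fiberLIntegral_mul_comp_mk`, `measurable_fiberLIntegral`
import Literature.MeasureTheory.Group.InvariantQuotientUniqueness        -- ★ `exists_measurable_fiberLIntegral_pos_lt_top`
import Literature.MeasureTheory.Group.InvariantQuotientProd              -- ★ `QuotientGroup.quotientProdHomeomorph`, `coe_quotientProdHomeomorph`
import Literature.MeasureTheory.Group.ConjugationFamilyFibres           -- ★ `continuous_conjFamily_and_smul`
import Literature.Topology.Metrizable.LocallyCompactPolish              -- ★ `polishSpace_of_locallyCompactSpace_of_secondCountableTopology`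
import Mathlib.MeasureTheory.Measure.Haar.Unique
import Mathlib.MeasureTheory.Constructions.Polish.Basic
import HarnessLib

/-!
# The local tube-Jacobian socket on a product with a compact abelian factor
# (Harish-Chandra 1970, Lemma 22; Weil's quotient-integral formula, Folland 1995 §2.6)

Generic measure theory on locally compact groups.  THEOREMS ONLY; sorry-free; no definition ∕ instance ∕ notation ∕ named fact.

SETTING.  `G₂` a locally compact, second countable, Hausdorff group, `T₂ ≤ G₂` a CLOSED ABELIAN subgroup with conjugation family
`Φ₂ : (G₂ ⧸ T₂) × T₂ → G₂`, `Φ₂(xT₂, t) = x t x⁻¹`; `K` a COMPACT ABELIAN second countable Hausdorff group; on the product `G₂ × K` the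
subgroup `T = T₂ × K` (`Subgroup.prod T₂ ⊤`, closed abelian) with conjugation family `Φ`.  A *local tube-Jacobian socket* at `(G, T, Φ)` for
Haar data `(ν, tm)` (`ν` a Haar measure on `G`, `tm` a left-invariant measure on `T`), a weight `D : T → ℝ≥0` and a regularity predicate `R`
is the statement (the `hJacLoc` binder of the Weyl-integration files of `Summits/HodgeConjecture/…/F0P3cStCharTSWeylCartanJacobian`, by shape):
every `R`-regular `t₀ ∈ T` has an open `U ∋ t₀` and a Borel `A₀ ⊆ G ⧸ T` of positive finite quotient mass `μ₀ = ν ∕ tm` such that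
`ν (Φ(A₀ × V)) = μ₀(A₀) · ∫⁻_V D dtm` for every Borel, `R`-regular, `W`-free `V ⊆ U`.

MAIN RESULT **`tubeJacobianLocal_prod_compactFactor`** (`T₂` closed; corollary **`tubeJacobianLocal_prod_compact`** for `T₂` compact, same letters):
if the socket holds on `(G₂, T₂, Φ₂)` for ALL Haar data, a Borel weight `D₂ : G₂ → ℝ≥0` and a predicate `R₂`, then it holds on `(G₂ × K, T₂ × K, Φ)`
for all Haar data, the weight `D₂ ∘ Prod.fst` and every predicate `R` with `R (g, k) → R₂ g`.  PROOF (Fubini over the compact factor):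
`ν = c • (fst_* ν) ⊗ μ_K`, `π_* tm = c′ • (π₁)_* tm ⊗ μ_K` on `T₂ × K` (Haar uniqueness, Mathlib `isMulLeftInvariant_eq_smul`; `π₁ : T₂ × K → T₂` is
proper); Weil's formula (★ `lintegral_fiberLIntegral_quotientMeasure`) on both coset spaces, tested against `u ⊗ 1` for a Borel `u` with prescribed
fibre integrals (★ `exists_measurable_fiberLIntegral_pos_lt_top`), gives `c′ · μ₀(ρ₁⁻¹ B) = c · μ₀₂(B)` along `ρ₁ : (G₂ × K) ⧸ T → G₂ ⧸ T₂`; the tube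
`Φ(A₀ × V)` is Borel (Lusin–Souslin: `Φ` is continuous and injective on `A₀ × V` for `V` `W`-free and `T` abelian) and its `k`-section is the `G₂`-tube
`Φ₂(A₀′ × V^k)` over the fibre `V^k = {t | (t, k) ∈ V}`, which is Borel, `R₂`-regular and `W`-free in `G₂`; the factor socket fibrewise and Tonelli
give the identity, the scalars cancelling.

## References
* [HarishChandra1970] Harish-Chandra (notes by G. van Dijk), *Harmonic analysis on reductive p-adic groups*, LNM 162 (1970), Part V §4 Lemma 22.
* [Folland1995] G. B. Folland, *A Course in Abstract Harmonic Analysis* (1995), §2.6 Thm. 2.49, (2.52).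
* [Kechris1995] A. S. Kechris, *Classical Descriptive Set Theory* (1995), Thm. 15.1 (Lusin–Souslin).
-/

set_option autoImplicit false

noncomputable section

open MeasureTheory Measure Set Filter Topology Function
open scoped ENNReal NNReal Pointwise

namespace Literature.MeasureTheory.Group

-- The coset spaces carry the Borel σ-algebras supplied by the binders `[MeasurableSpace (G ⧸ T)] [BorelSpace (G ⧸ T)]` (local instances take
-- precedence over Mathlib's quotient σ-algebra instance), as in ★ `InvariantQuotientCompactSubgroup`.

/-! ## §1 The tube of a conjugation family over a `W`-free set of an abelian subgroup is Borel -/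

section Tube

variable {G : Type*} [Group G] [TopologicalSpace G] [IsTopologicalGroup G] [LocallyCompactSpace G] [SecondCountableTopology G] [T2Space G]
  [MeasurableSpace G] [BorelSpace G]
  (T : Subgroup G) (hTc : IsClosed (T : Set G)) (hab : ∀ a ∈ T, ∀ b ∈ T, a * b = b * a)
  (Φ : (G ⧸ T) × ↥T → G) (hΦ : ∀ (x : G) (t : ↥T), Φ (QuotientGroup.mk x, t) = x * t * x⁻¹)

include hab hΦ in
omit [TopologicalSpace G] [IsTopologicalGroup G] [LocallyCompactSpace G] [SecondCountableTopology G] [T2Space G] [MeasurableSpace G] [BorelSpace G] in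
/-- **Injectivity of the conjugation family over a `W`-free set of an abelian `T`**: `x t x⁻¹ = x′ t′ x′⁻¹` with `t, t′ ∈ V` forces `xT = x′T` and
`t = t′` (`n := x′⁻¹ x` conjugates `t` to `t′`; `n ∉ T` is excluded by `W`-freeness, `n ∈ T` acts trivially). [cite: HarishChandra1970, Lemma 22] -/
theorem injOn_conjFamily_prod_of_wFree (A₀ : Set (G ⧸ T)) {V : Set ↥T}
    (hW : ∀ n : G, n ∉ T → ∀ t ∈ V, ∀ t' ∈ V, ((t' : ↥T) : G) ≠ n * t * n⁻¹) : InjOn Φ (A₀ ×ˢ V) := by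
  rintro ⟨q, t⟩ ⟨-, ht⟩ ⟨q', t'⟩ ⟨-, ht'⟩ h
  obtain ⟨x, rfl⟩ := QuotientGroup.mk_surjective q
  obtain ⟨x', rfl⟩ := QuotientGroup.mk_surjective q'
  rw [hΦ, hΦ] at h
  have hconj : (x'⁻¹ * x) * (t : G) * (x'⁻¹ * x)⁻¹ = (t' : G) := by
    calc (x'⁻¹ * x) * (t : G) * (x'⁻¹ * x)⁻¹ = x'⁻¹ * (x * (t : G) * x⁻¹) * x' := by group
      _ = x'⁻¹ * (x' * (t' : G) * x'⁻¹) * x' := by rw [h]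
      _ = (t' : G) := by group
  by_cases hn : x'⁻¹ * x ∈ T
  · have htt : (t : G) = t' := by
      rw [← hconj, hab _ hn _ t.2, mul_inv_cancel_right]
    refine Prod.ext ?_ (Subtype.ext htt)
    change (QuotientGroup.mk x : G ⧸ T) = QuotientGroup.mk x'
    rw [eq_comm, QuotientGroup.eq]
    exact hn
  · exact absurd hconj.symm (hW _ hn t ht t' ht')

include hTc hab hΦ in
/-- **The tube `Φ(A₀ × V)` over a Borel `W`-free `V` is Borel** (`A₀ ⊆ G ⧸ T` Borel, `T` closed abelian): `Φ` is continuous (★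
`continuous_conjFamily_and_smul`) and injective on `A₀ × V`, and `(G ⧸ T) × T` is Polish — Lusin–Souslin. [cite: Kechris1995, Thm. 15.1]
[cite: HarishChandra1970, Lemma 22] -/
theorem measurableSet_image_conjFamily_prod [MeasurableSpace (G ⧸ T)] [BorelSpace (G ⧸ T)]
    {A₀ : Set (G ⧸ T)} (hA₀ : MeasurableSet A₀) {V : Set ↥T} (hV : MeasurableSet V)
    (hW : ∀ n : G, n ∉ T → ∀ t ∈ V, ∀ t' ∈ V, ((t' : ↥T) : G) ≠ n * t * n⁻¹) : MeasurableSet (Φ '' (A₀ ×ˢ V)) := by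
  haveI : IsClosed (T : Set G) := hTc
  haveI : T2Space (G ⧸ T) := inferInstance
  haveI : PolishSpace (G ⧸ T) := Literature.Topology.Metrizable.polishSpace_of_locallyCompactSpace_of_secondCountableTopology _
  haveI : PolishSpace G := Literature.Topology.Metrizable.polishSpace_of_locallyCompactSpace_of_secondCountableTopology G
  haveI : PolishSpace ↥T := hTc.polishSpace
  have hΦc : Continuous Φ := (continuous_conjFamily_and_smul T Φ hΦ).1
  exact (hA₀.prod hV).image_of_continuousOn_injOn hΦc.continuousOn (injOn_conjFamily_prod_of_wFree T hab Φ hΦ A₀ hW)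

end Tube

/-! ## §2 Haar measures on a product with a compact factor -/

section HaarProd

variable {G₂ K : Type*} [Group G₂] [TopologicalSpace G₂] [IsTopologicalGroup G₂] [LocallyCompactSpace G₂] [SecondCountableTopology G₂] [T2Space G₂]
  [MeasurableSpace G₂] [BorelSpace G₂]
  [Group K] [TopologicalSpace K] [IsTopologicalGroup K] [CompactSpace K] [SecondCountableTopology K] [T2Space K]
  [MeasurableSpace K] [BorelSpace K]

omit [LocallyCompactSpace G₂] [SecondCountableTopology G₂] [T2Space K] in
/-- **The first marginal of a Haar measure on `G₂ × K` (`K` compact) is a right-invariant Haar measure on `G₂`** (`(fst_* ν)(B) = ν(B × K)`).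
[cite: Folland1995, §2.2] -/
theorem isHaarMeasure_map_fst (ν : Measure (G₂ × K)) [ν.IsHaarMeasure] [ν.IsMulRightInvariant] :
    (ν.map Prod.fst : Measure G₂).IsHaarMeasure ∧ (ν.map Prod.fst : Measure G₂).IsMulRightInvariant := by
  have hmeas : Measurable (Prod.fst : G₂ × K → G₂) := measurable_fst
  have hfin : IsFiniteMeasureOnCompacts (ν.map Prod.fst : Measure G₂) := by
    refine ⟨fun C hC => ?_⟩
    rw [Measure.map_apply hmeas hC.measurableSet]
    have hsub : (Prod.fst ⁻¹' C : Set (G₂ × K)) ⊆ C ×ˢ univ := fun p hp => ⟨hp, mem_univ _⟩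
    exact (measure_mono hsub).trans_lt ((hC.prod isCompact_univ).measure_lt_top)
  have hleft : (ν.map Prod.fst : Measure G₂).IsMulLeftInvariant :=
    isMulLeftInvariant_map (MonoidHom.fst G₂ K).toMulHom hmeas Prod.fst_surjective
  have hopen : (ν.map Prod.fst : Measure G₂).IsOpenPosMeasure := continuous_fst.isOpenPosMeasure_map Prod.fst_surjective
  refine ⟨{ toIsFiniteMeasureOnCompacts := hfin, toIsMulLeftInvariant := hleft, toIsOpenPosMeasure := hopen }, ?_⟩
  refine ⟨fun g => ?_⟩
  rw [Measure.map_map (measurable_mul_const g) hmeas]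
  have hcomp : (fun x : G₂ => x * g) ∘ (Prod.fst : G₂ × K → G₂) = Prod.fst ∘ fun p : G₂ × K => p * (g, 1) := by
    funext p; simp
  rw [hcomp, ← Measure.map_map hmeas (measurable_mul_const _), map_mul_right_eq_self]

/-- **A Haar measure on `G₂ × K` is a positive finite multiple of `(fst_* ν) ⊗ μ_K`** for any Haar measure `μ_K` of the compact factor
(Haar uniqueness on the second countable group `G₂ × K`). [cite: Folland1995, §2.2 Thm. 2.20] -/
theorem exists_eq_smul_map_fst_prod (ν : Measure (G₂ × K)) [ν.IsHaarMeasure] [ν.IsMulRightInvariant] (μK : Measure K) [μK.IsHaarMeasure] :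
    ∃ c : ℝ≥0∞, c ≠ 0 ∧ c ≠ ∞ ∧ ν = c • (ν.map Prod.fst).prod μK := by
  haveI := (isHaarMeasure_map_fst ν).1
  haveI : ((ν.map Prod.fst).prod μK).IsHaarMeasure := inferInstance
  refine ⟨haarScalarFactor ν ((ν.map Prod.fst).prod μK), ?_, ENNReal.coe_ne_top, ?_⟩
  · exact ENNReal.coe_ne_zero.2 (haarScalarFactor_pos_of_isHaarMeasure _ _).ne'
  · simpa only [ENNReal.smul_def] using isMulLeftInvariant_eq_smul ν _

end HaarProd

/-! ## §3 The socket on `G₂ × K` at `T₂ × K` from the socket on `G₂` at `T₂` -/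

section Socket

variable {G₂ K : Type*} [Group G₂] [TopologicalSpace G₂] [IsTopologicalGroup G₂] [LocallyCompactSpace G₂] [SecondCountableTopology G₂] [T2Space G₂]
  [MeasurableSpace G₂] [BorelSpace G₂]
  [Group K] [TopologicalSpace K] [IsTopologicalGroup K] [CompactSpace K] [SecondCountableTopology K] [T2Space K]
  [MeasurableSpace K] [BorelSpace K]

/-- **THE LOCAL TUBE-JACOBIAN SOCKET ON A PRODUCT WITH A COMPACT ABELIAN FACTOR.**  `T₂ ≤ G₂` CLOSED abelian with conjugation family `Φ₂`, `K` compact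
abelian; suppose the socket holds on `(G₂, T₂, Φ₂)` for every Haar datum `(ν₂, tm₂)`, the Borel weight `D₂` and the predicate `R₂` (hypothesis `hsock₂`, the
conclusion shape of the Cartan tube-Jacobian theorems of `Summits/…/F0P3cStCharTSJacCartanWeightDock` ∕ `…WeylHypJacobianCartanM`).  Then for `T = T₂ × K ≤ G₂ × K`
with conjugation family `Φ`, every Haar datum `(ν, tm)`, every weight `D` with `D t = D₂ (t.1)` and every predicate `R` with `R (g, k) → R₂ g`: every `R`-regular
`t₀ ∈ T` has an open `U ∋ t₀` and a Borel `A₀ ⊆ (G₂ × K) ⧸ T` with `0 < (ν∕tm)(A₀) < ∞` such that `ν (Φ(A₀ × V)) = (ν∕tm)(A₀) · ∫⁻_V D dtm` for all Borel, `R`-regular,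
`W`-free `V ⊆ U`.  [cite: HarishChandra1970, Lemma 22] [cite: Folland1995, §2.6 Thm. 2.49, (2.52)] -/
theorem tubeJacobianLocal_prod_compactFactor
    {T₂ : Subgroup G₂} (hab₂ : ∀ a ∈ T₂, ∀ b ∈ T₂, a * b = b * a)
    (hK : ∀ a b : K, a * b = b * a)
    (Φ₂ : (G₂ ⧸ T₂) × ↥T₂ → G₂) (hΦ₂ : ∀ (x : G₂) (t : ↥T₂), Φ₂ (QuotientGroup.mk x, t) = x * t * x⁻¹)
    [MeasurableSpace (G₂ ⧸ T₂)] [BorelSpace (G₂ ⧸ T₂)] (hT₂c : IsClosed (T₂ : Set G₂))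
    (R₂ : G₂ → Prop) (D₂ : G₂ → ℝ≥0) (hD₂m : Measurable D₂)
    (hsock₂ : ∀ (ν₂ : Measure G₂) [ν₂.IsHaarMeasure] [ν₂.IsMulRightInvariant]
      (tm₂ : Measure ↥T₂) [tm₂.IsMulLeftInvariant] [IsFiniteMeasureOnCompacts tm₂] [tm₂.IsOpenPosMeasure] [tm₂.IsInvInvariant],
      ∀ t₀ : ↥T₂, R₂ (t₀ : G₂) →
        ∃ U : Set ↥T₂, IsOpen U ∧ t₀ ∈ U ∧
          ∃ A₀ : Set (G₂ ⧸ T₂), MeasurableSet A₀ ∧ quotientMeasure T₂ tm₂ hT₂c ν₂ A₀ ≠ 0 ∧ quotientMeasure T₂ tm₂ hT₂c ν₂ A₀ ≠ ∞ ∧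
            ∀ V : Set ↥T₂, MeasurableSet V → V ⊆ U → (∀ t ∈ V, R₂ ((t : ↥T₂) : G₂)) →
              (∀ n : G₂, n ∉ T₂ → ∀ t ∈ V, ∀ t' ∈ V, ((t' : ↥T₂) : G₂) ≠ n * t * n⁻¹) →
                ν₂ (Φ₂ '' (A₀ ×ˢ V)) = quotientMeasure T₂ tm₂ hT₂c ν₂ A₀ * ∫⁻ t in V, (D₂ (t : G₂) : ℝ≥0∞) ∂tm₂)
    {T : Subgroup (G₂ × K)} (hT : T = T₂.prod ⊤) (hTc : IsClosed (T : Set (G₂ × K)))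
    (Φ : ((G₂ × K) ⧸ T) × ↥T → G₂ × K) (hΦ : ∀ (x : G₂ × K) (t : ↥T), Φ (QuotientGroup.mk x, t) = x * t * x⁻¹)
    [MeasurableSpace ((G₂ × K) ⧸ T)] [BorelSpace ((G₂ × K) ⧸ T)]
    (ν : Measure (G₂ × K)) [ν.IsHaarMeasure] [ν.IsMulRightInvariant]
    (tm : Measure ↥T) [tm.IsMulLeftInvariant] [IsFiniteMeasureOnCompacts tm] [tm.IsOpenPosMeasure] [tm.IsInvInvariant]
    (R : G₂ × K → Prop) (hR : ∀ p, R p → R₂ p.1)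
    (D : ↥T → ℝ≥0) (hD : ∀ t : ↥T, D t = D₂ (t : G₂ × K).1) :
    ∀ t₀ : ↥T, R (t₀ : G₂ × K) →
      ∃ U : Set ↥T, IsOpen U ∧ t₀ ∈ U ∧
        ∃ A₀ : Set ((G₂ × K) ⧸ T), MeasurableSet A₀ ∧ quotientMeasure T tm hTc ν A₀ ≠ 0 ∧ quotientMeasure T tm hTc ν A₀ ≠ ∞ ∧
          ∀ V : Set ↥T, MeasurableSet V → V ⊆ U → (∀ t ∈ V, R ((t : ↥T) : G₂ × K)) →
            (∀ n : G₂ × K, n ∉ T → ∀ t ∈ V, ∀ t' ∈ V, ((t' : ↥T) : G₂ × K) ≠ n * t * n⁻¹) →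
              ν (Φ '' (A₀ ×ˢ V)) = quotientMeasure T tm hTc ν A₀ * ∫⁻ t in V, (D t : ℝ≥0∞) ∂tm := by
  subst hT
  intro t₀ ht₀
  classical
  /- ### (A) instances -/
  haveI : IsClosed (T₂ : Set G₂) := hT₂c
  haveI : IsClosed ((T₂.prod (⊤ : Subgroup K) : Subgroup (G₂ × K)) : Set (G₂ × K)) := hTc
  haveI : LocallyCompactSpace ↥T₂ := hT₂c.isClosedEmbedding_subtypeVal.locallyCompactSpace
  haveI : LocallyCompactSpace ↥(T₂.prod (⊤ : Subgroup K)) := hTc.isClosedEmbedding_subtypeVal.locallyCompactSpace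
  haveI : tm.IsHaarMeasure := { toIsFiniteMeasureOnCompacts := ‹_›, toIsMulLeftInvariant := ‹_›, toIsOpenPosMeasure := ‹_› }
  -- `T₂ × K` is abelian
  have habT : ∀ a ∈ T₂.prod (⊤ : Subgroup K), ∀ b ∈ T₂.prod (⊤ : Subgroup K), a * b = b * a := by
    intro a ha b hb
    rw [Subgroup.mem_prod] at ha hb
    exact Prod.ext (hab₂ _ ha.1 _ hb.1) (hK _ _)
  /- ### (B) the group isomorphism `π : T₂ × K (as a subgroup of G₂ × K) ≃ T₂ × K` -/
  let π : ↥(T₂.prod (⊤ : Subgroup K)) ≃* ↥T₂ × K :=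
    (Subgroup.prodEquiv T₂ (⊤ : Subgroup K)).trans (MulEquiv.prodCongr (MulEquiv.refl ↥T₂) (Subgroup.topEquiv : (⊤ : Subgroup K) ≃* K))
  have hπ1 : ∀ s : ↥(T₂.prod (⊤ : Subgroup K)), (((π s).1 : ↥T₂) : G₂) = (s : G₂ × K).1 := fun s => rfl
  have hπ2 : ∀ s : ↥(T₂.prod (⊤ : Subgroup K)), (π s).2 = (s : G₂ × K).2 := fun s => rfl
  have hπsymm : ∀ (t : ↥T₂) (k : K), ((π.symm (t, k) : ↥(T₂.prod (⊤ : Subgroup K))) : G₂ × K) = ((t : G₂), k) := fun t k => rfl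
  have hπc : Continuous π :=
    continuous_prodMk.2
      ⟨continuous_induced_rng.2 ((continuous_fst.comp continuous_subtype_val).congr fun s => (hπ1 s).symm),
        (continuous_snd.comp continuous_subtype_val).congr fun s => (hπ2 s).symm⟩
  have hπsc : Continuous π.symm :=
    continuous_induced_rng.2 (((continuous_subtype_val.comp continuous_fst).prodMk continuous_snd).congr fun p => (hπsymm p.1 p.2).symm)
  let πc : ↥(T₂.prod (⊤ : Subgroup K)) ≃ₜ* (↥T₂ × K) := { π with continuous_toFun := hπc, continuous_invFun := hπsc }
  have hπcπ : (πc : ↥(T₂.prod (⊤ : Subgroup K)) → ↥T₂ × K) = π := rfl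
  let πm : ↥(T₂.prod (⊤ : Subgroup K)) ≃ᵐ (↥T₂ × K) := πc.toHomeomorph.toMeasurableEquiv
  have hπmπ : (πm : ↥(T₂.prod (⊤ : Subgroup K)) → ↥T₂ × K) = π := rfl
  have hπmeas : Measurable π := hπc.measurable
  /- ### (C) the Haar data on the factors -/
  -- `ν₂ := fst_* ν`, `ν = c • ν₂ ⊗ μK`
  set ν₂ : Measure G₂ := ν.map Prod.fst with hν₂def
  haveI : ν₂.IsHaarMeasure := (isHaarMeasure_map_fst ν).1
  haveI : ν₂.IsMulRightInvariant := (isHaarMeasure_map_fst ν).2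
  set μK : Measure K := Measure.haar with hμKdef
  obtain ⟨c, hc0, hctop, hνc⟩ := exists_eq_smul_map_fst_prod ν μK
  have hμK0 : μK univ ≠ 0 := (isOpen_univ.measure_pos μK univ_nonempty).ne'
  have hμKtop : μK univ ≠ ∞ := measure_ne_top μK _
  -- `tm₂ := (π₁)_* tm` (`π₁` is proper since `K` is compact)
  let π₁ : ↥(T₂.prod (⊤ : Subgroup K)) →* ↥T₂ := (MonoidHom.fst ↥T₂ K).comp π.toMonoidHom
  have hπ₁_apply : ∀ s, π₁ s = (π s).1 := fun s => rfl
  have hπ₁c : Continuous π₁ := continuous_fst.comp hπc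
  have hπ₁s : Surjective π₁ := fun t => ⟨π.symm (t, 1), by rw [hπ₁_apply, MulEquiv.apply_symm_apply]⟩
  set tm₂ : Measure ↥T₂ := tm.map π₁ with htm₂def
  haveI : tm₂.IsMulLeftInvariant := isMulLeftInvariant_map π₁.toMulHom hπ₁c.measurable hπ₁s
  haveI : IsFiniteMeasureOnCompacts tm₂ := by
    refine ⟨fun C hC => ?_⟩
    rw [htm₂def, Measure.map_apply hπ₁c.measurable hC.measurableSet]
    have hpre : (π₁ : ↥(T₂.prod (⊤ : Subgroup K)) → ↥T₂) ⁻¹' C = πc.toHomeomorph ⁻¹' (C ×ˢ (univ : Set K)) := by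
      ext s
      simp only [mem_preimage, hπ₁_apply, mem_prod, mem_univ, and_true]
      rfl
    rw [hpre]
    exact (πc.toHomeomorph.isCompact_preimage.2 (hC.prod isCompact_univ)).measure_lt_top
  haveI : tm₂.IsOpenPosMeasure := hπ₁c.isOpenPosMeasure_map hπ₁s
  haveI : tm₂.IsHaarMeasure := { toIsFiniteMeasureOnCompacts := ‹_›, toIsMulLeftInvariant := ‹_›, toIsOpenPosMeasure := ‹_› }
  haveI : tm₂.IsInvInvariant := by
    refine ⟨?_⟩
    change Measure.map Inv.inv tm₂ = tm₂
    rw [htm₂def, Measure.map_map measurable_inv hπ₁c.measurable]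
    have h : ((Inv.inv : ↥T₂ → ↥T₂) ∘ π₁) = π₁ ∘ (Inv.inv : ↥(T₂.prod (⊤ : Subgroup K)) → ↥(T₂.prod (⊤ : Subgroup K))) :=
      funext fun s => (map_inv π₁ s).symm
    rw [h, ← Measure.map_map hπ₁c.measurable measurable_inv, Measure.map_inv_eq_self]
  -- `π_* tm = c' • tm₂ ⊗ μK`
  haveI : (tm.map π).IsHaarMeasure := by rw [← hπcπ]; exact πc.isHaarMeasure_map tm
  obtain ⟨c', hc'0, hc'top, htmc⟩ : ∃ c' : ℝ≥0∞, c' ≠ 0 ∧ c' ≠ ∞ ∧ tm.map π = c' • tm₂.prod μK := by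
    refine ⟨haarScalarFactor (tm.map π) (tm₂.prod μK), ?_, ENNReal.coe_ne_top, ?_⟩
    · exact ENNReal.coe_ne_zero.2 (haarScalarFactor_pos_of_isHaarMeasure _ _).ne'
    · simpa only [ENNReal.smul_def] using isMulLeftInvariant_eq_smul (tm.map π) _
  -- integrals against `tm` of functions of `(↑s).1`, read on `tm₂`
  have hfibre : ∀ u : G₂ → ℝ≥0∞, Measurable u → ∀ g : G₂,
      ∫⁻ s : ↥(T₂.prod (⊤ : Subgroup K)), u (g * ((s : G₂ × K)).1) ∂tm = c' * (μK univ * ∫⁻ t : ↥T₂, u (g * (t : G₂)) ∂tm₂) := by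
    intro u hu g
    have hum : Measurable fun p : ↥T₂ × K => u (g * ((p.1 : ↥T₂) : G₂)) :=
      hu.comp (measurable_const.mul (measurable_subtype_coe.comp measurable_fst))
    have h1 : ∫⁻ s : ↥(T₂.prod (⊤ : Subgroup K)), u (g * ((s : G₂ × K)).1) ∂tm = ∫⁻ p, u (g * ((p.1 : ↥T₂) : G₂)) ∂(tm.map π) := by
      rw [← hπmπ, lintegral_map_equiv]
      rfl
    rw [h1, htmc, lintegral_smul_measure, smul_eq_mul, lintegral_prod _ hum.aemeasurable]
    congr 1
    simp_rw [lintegral_const]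
    rw [lintegral_mul_const' _ _ hμKtop, mul_comm]
  /- ### (D) Weil's formula on both coset spaces: `c' · μ₀(ρ₁⁻¹ B) = c · μ₀₂(B)` -/
  -- `ρ₁ : (G₂ × K) ⧸ (T₂ × K) → G₂ ⧸ T₂`, `(x, k)(T₂ × K) ↦ x T₂`
  let ρ₁ : (G₂ × K) ⧸ T₂.prod (⊤ : Subgroup K) → G₂ ⧸ T₂ := fun q => (QuotientGroup.prodEquiv T₂ (⊤ : Subgroup K) q).1
  have hρ₁_mk : ∀ p : G₂ × K, ρ₁ (QuotientGroup.mk p) = QuotientGroup.mk p.1 := fun p => rfl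
  have hρ₁c : Continuous ρ₁ := continuous_fst.comp (continuous_prodEquiv T₂ (⊤ : Subgroup K))
  have hkey : ∀ B : Set (G₂ ⧸ T₂), MeasurableSet B →
      c' * quotientMeasure (T₂.prod (⊤ : Subgroup K)) tm hTc ν (ρ₁ ⁻¹' B) = c * quotientMeasure T₂ tm₂ hT₂c ν₂ B := by
    intro B hB
    -- a Borel `u₀ ≥ 0` on `G₂` with fibre integrals `ψ` everywhere in `(0, ∞)`
    obtain ⟨u₀, hu₀m, hu₀⟩ := exists_measurable_fiberLIntegral_pos_lt_top T₂ tm₂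
    set ψ : G₂ ⧸ T₂ → ℝ≥0∞ := fiberLIntegral T₂ tm₂ u₀ with hψdef
    have hψm : Measurable ψ := measurable_fiberLIntegral T₂ tm₂ hu₀m
    -- the test function `u` with fibre integral `1_B`
    set Fq : G₂ ⧸ T₂ → ℝ≥0∞ := fun q => B.indicator (fun _ => (1 : ℝ≥0∞)) q * (ψ q)⁻¹ with hFqdef
    have hFqm : Measurable Fq := (measurable_const.indicator hB).mul hψm.inv
    set u : G₂ → ℝ≥0∞ := fun g => u₀ g * Fq (QuotientGroup.mk g) with hudef
    have hmk₂ : Measurable (QuotientGroup.mk : G₂ → G₂ ⧸ T₂) := QuotientGroup.continuous_mk.measurable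
    have hum : Measurable u := hu₀m.mul (hFqm.comp hmk₂)
    have hfib₂ : ∀ q : G₂ ⧸ T₂, fiberLIntegral T₂ tm₂ u q = B.indicator (fun _ => (1 : ℝ≥0∞)) q := by
      intro q
      rw [hudef, fiberLIntegral_mul_comp_mk T₂ tm₂ hu₀m Fq q, hFqdef]
      change ψ q * (B.indicator (fun _ => (1 : ℝ≥0∞)) q * (ψ q)⁻¹) = _
      by_cases hq : q ∈ B
      · rw [indicator_of_mem hq, one_mul, ENNReal.mul_inv_cancel (hu₀ q).1.ne' (hu₀ q).2.ne]
      · rw [indicator_of_notMem hq, zero_mul, mul_zero]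
    -- Weil on `G₂`
    have hW₂ : ∫⁻ g, u g ∂ν₂ = quotientMeasure T₂ tm₂ hT₂c ν₂ B := by
      rw [← lintegral_fiberLIntegral_quotientMeasure T₂ tm₂ ν₂ hum]
      simp_rw [hfib₂]
      rw [lintegral_indicator hB, setLIntegral_const, one_mul]
    -- the fibre integrals of `u ∘ fst` on the product
    have hufm : Measurable (u ∘ (Prod.fst : G₂ × K → G₂)) := hum.comp measurable_fst
    have hfibT : ∀ x : G₂ × K, fiberLIntegral (T₂.prod (⊤ : Subgroup K)) tm (u ∘ (Prod.fst : G₂ × K → G₂)) (QuotientGroup.mk x) =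
        c' * (μK univ * B.indicator (fun _ => (1 : ℝ≥0∞)) (QuotientGroup.mk x.1)) := by
      intro x
      rw [fiberLIntegral_mk]
      have h1 : (fun s : ↥(T₂.prod (⊤ : Subgroup K)) => (u ∘ (Prod.fst : G₂ × K → G₂)) (x * (s : G₂ × K))) =
          fun s : ↥(T₂.prod (⊤ : Subgroup K)) => u (x.1 * ((s : G₂ × K)).1) := by
        funext s; simp only [comp_apply, Prod.fst_mul]
      rw [h1, hfibre u hum x.1, ← fiberLIntegral_mk T₂ tm₂ u x.1, hfib₂]
    -- Weil on `G₂ × K`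
    have hWT := lintegral_fiberLIntegral_quotientMeasure (T₂.prod (⊤ : Subgroup K)) tm ν hufm
    have hL : ∫⁻ q, fiberLIntegral (T₂.prod (⊤ : Subgroup K)) tm (u ∘ (Prod.fst : G₂ × K → G₂)) q ∂quotientMeasure (T₂.prod (⊤ : Subgroup K)) tm hTc ν =
        c' * (μK univ * quotientMeasure (T₂.prod (⊤ : Subgroup K)) tm hTc ν (ρ₁ ⁻¹' B)) := by
      have h2 : (fun q => fiberLIntegral (T₂.prod (⊤ : Subgroup K)) tm (u ∘ (Prod.fst : G₂ × K → G₂)) q) =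
          fun q => c' * (μK univ * (ρ₁ ⁻¹' B).indicator (fun _ => (1 : ℝ≥0∞)) q) := by
        funext q
        induction q using QuotientGroup.induction_on with
        | H x =>
          rw [hfibT x]
          simp only [indicator, mem_preimage, hρ₁_mk]
      rw [h2, lintegral_const_mul' _ _ hc'top, lintegral_const_mul' _ _ hμKtop, lintegral_indicator (hB.preimage hρ₁c.measurable),
        setLIntegral_const, one_mul]
    have hRt : ∫⁻ p, (u ∘ (Prod.fst : G₂ × K → G₂)) p ∂ν = c * (μK univ * quotientMeasure T₂ tm₂ hT₂c ν₂ B) := by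
      rw [hνc, lintegral_smul_measure, smul_eq_mul, lintegral_prod _ hufm.aemeasurable]
      congr 1
      simp only [comp_apply, lintegral_const]
      rw [lintegral_mul_const' _ _ hμKtop, hW₂, mul_comm]
    rw [hL, hRt] at hWT
    -- cancel `μK(K)`
    have h3 : μK univ * (c' * quotientMeasure (T₂.prod (⊤ : Subgroup K)) tm hTc ν (ρ₁ ⁻¹' B)) = μK univ * (c * quotientMeasure T₂ tm₂ hT₂c ν₂ B) := by
      calc μK univ * (c' * quotientMeasure (T₂.prod (⊤ : Subgroup K)) tm hTc ν (ρ₁ ⁻¹' B))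
          = c' * (μK univ * quotientMeasure (T₂.prod (⊤ : Subgroup K)) tm hTc ν (ρ₁ ⁻¹' B)) := by ring
        _ = c * (μK univ * quotientMeasure T₂ tm₂ hT₂c ν₂ B) := hWT
        _ = μK univ * (c * quotientMeasure T₂ tm₂ hT₂c ν₂ B) := by ring
    exact (ENNReal.mul_right_inj hμK0 hμKtop).1 h3
  /- ### (E) the factor socket at `(ν₂, tm₂)`, the neighbourhood `U`, the transversal class `A₀` -/
  have ht₀₂ : R₂ (((π t₀).1 : ↥T₂) : G₂) := by rw [hπ1]; exact hR _ ht₀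
  obtain ⟨U₂, hU₂o, ht₀U₂, A₂, hA₂m, hA₂0, hA₂top, hJ₂⟩ := hsock₂ ν₂ tm₂ (π t₀).1 ht₀₂
  set U : Set ↥(T₂.prod (⊤ : Subgroup K)) := (fun s => (π s).1) ⁻¹' U₂ with hUdef
  have hUo : IsOpen U := hU₂o.preimage (continuous_fst.comp hπc)
  set A₀ : Set ((G₂ × K) ⧸ T₂.prod (⊤ : Subgroup K)) := ρ₁ ⁻¹' A₂ with hA₀def
  have hA₀m : MeasurableSet A₀ := hA₂m.preimage hρ₁c.measurable
  have hA₀key : c' * quotientMeasure (T₂.prod (⊤ : Subgroup K)) tm hTc ν A₀ = c * quotientMeasure T₂ tm₂ hT₂c ν₂ A₂ := hkey A₂ hA₂m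
  refine ⟨U, hUo, ht₀U₂, A₀, hA₀m, ?_, ?_, fun V hVm hVU hVreg hVW => ?_⟩
  · intro h0
    rw [h0, mul_zero] at hA₀key
    exact (mul_ne_zero hc0 hA₂0) hA₀key.symm
  · intro htop
    rw [htop, ENNReal.mul_top hc'0] at hA₀key
    exact (ENNReal.mul_ne_top hctop hA₂top) hA₀key.symm
  /- ### (F) the fibres `V^k ⊆ T₂` of a Borel, regular, `W`-free `V ⊆ U` -/
  set Vk : K → Set ↥T₂ := fun k => (fun t : ↥T₂ => π.symm (t, k)) ⁻¹' V with hVkdef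
  have hVk_mem : ∀ k t, t ∈ Vk k ↔ π.symm (t, k) ∈ V := fun k t => Iff.rfl
  have hVkm : ∀ k, MeasurableSet (Vk k) := fun k =>
    hVm.preimage (hπsc.comp (continuous_id.prodMk continuous_const)).measurable
  have hVkU : ∀ k, Vk k ⊆ U₂ := by
    intro k t ht
    have h := hVU ((hVk_mem k t).1 ht)
    rw [hUdef, mem_preimage, MulEquiv.apply_symm_apply] at h
    exact h
  have hVkreg : ∀ k, ∀ t ∈ Vk k, R₂ ((t : ↥T₂) : G₂) := by
    intro k t ht
    have h := hR _ (hVreg _ ((hVk_mem k t).1 ht))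
    rwa [hπsymm] at h
  have hVkW : ∀ k, ∀ n : G₂, n ∉ T₂ → ∀ t ∈ Vk k, ∀ t' ∈ Vk k, ((t' : ↥T₂) : G₂) ≠ n * t * n⁻¹ := by
    intro k n hn t ht t' ht' hEq
    have hn' : ((n, (1 : K)) : G₂ × K) ∉ T₂.prod (⊤ : Subgroup K) := by
      rw [Subgroup.mem_prod]; exact fun h => hn h.1
    refine hVW (n, 1) hn' _ ((hVk_mem k t).1 ht) _ ((hVk_mem k t').1 ht') ?_
    rw [hπsymm, hπsymm, hEq]
    ext <;> simp
  /- ### (G) the tube and its sections -/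
  have hS : MeasurableSet (Φ '' (A₀ ×ˢ V)) :=
    measurableSet_image_conjFamily_prod (T₂.prod (⊤ : Subgroup K)) hTc habT Φ hΦ hA₀m hVm hVW
  have hsec : ∀ k : K, (fun g : G₂ => (g, k)) ⁻¹' (Φ '' (A₀ ×ˢ V)) = Φ₂ '' (A₂ ×ˢ Vk k) := by
    intro k
    ext g
    simp only [mem_preimage, mem_image, mem_prod, Prod.exists]
    constructor
    · rintro ⟨q, s, ⟨hq, hs⟩, hqs⟩
      obtain ⟨⟨x, y⟩, rfl⟩ := QuotientGroup.mk_surjective q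
      obtain ⟨⟨t, k'⟩, rfl⟩ := π.symm.surjective s
      rw [hΦ, hπsymm] at hqs
      have h2 : y * k' * y⁻¹ = k := by simpa using (Prod.ext_iff.1 hqs).2
      have hk' : k' = k := by rw [← h2, hK y k', mul_inv_cancel_right]
      subst hk'
      refine ⟨QuotientGroup.mk x, t, ⟨?_, (hVk_mem _ t).2 hs⟩, ?_⟩
      · simpa [hA₀def, hρ₁_mk] using hq
      · rw [hΦ₂]; simpa using (Prod.ext_iff.1 hqs).1
    · rintro ⟨q₂, t, ⟨hq₂, ht⟩, rfl⟩
      obtain ⟨x, rfl⟩ := QuotientGroup.mk_surjective q₂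
      refine ⟨QuotientGroup.mk (x, 1), π.symm (t, k), ⟨?_, (hVk_mem k t).1 ht⟩, ?_⟩
      · rw [hA₀def, mem_preimage, hρ₁_mk]; exact hq₂
      · rw [hΦ, hΦ₂, hπsymm]; ext <;> simp
  /- ### (H) the computation -/
  set F : ↥T₂ × K → ℝ≥0∞ := fun p => (D₂ ((p.1 : ↥T₂) : G₂) : ℝ≥0∞) with hFdef
  have hFm : Measurable F :=
    (hD₂m.comp (continuous_subtype_val.comp continuous_fst).measurable).coe_nnreal_ennreal
  have hDπ : ∀ s : ↥(T₂.prod (⊤ : Subgroup K)), (D s : ℝ≥0∞) = F (π s) := by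
    intro s; rw [hFdef, hD, ← hπ1]
  set W : Set (↥T₂ × K) := π.symm ⁻¹' V with hWdef
  have hWm : MeasurableSet W := hVm.preimage hπsc.measurable
  have hπW : π ⁻¹' W = V := by
    ext s; simp [hWdef]
  -- change of variables along `π`, then `π_* tm = c' • tm₂ ⊗ μK`
  have hIV : ∫⁻ s in V, (D s : ℝ≥0∞) ∂tm = c' * ∫⁻ p in W, F p ∂(tm₂.prod μK) := by
    have h1 : ∫⁻ s in V, (D s : ℝ≥0∞) ∂tm = ∫⁻ s in V, F (π s) ∂tm := lintegral_congr fun s => hDπ s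
    have h2 : ∫⁻ p in W, F p ∂(tm.map π) = ∫⁻ s in V, F (π s) ∂tm := by
      rw [← hπmπ, MeasurableEquiv.restrict_map πm tm W, lintegral_map_equiv, hπmπ, hπW]
    rw [h1, ← h2, htmc, Measure.restrict_smul, lintegral_smul_measure, smul_eq_mul]
  -- Tonelli over the fibres
  have hTon : ∫⁻ k, ∫⁻ t in Vk k, (D₂ ((t : ↥T₂) : G₂) : ℝ≥0∞) ∂tm₂ ∂μK = ∫⁻ p in W, F p ∂(tm₂.prod μK) := by
    rw [← lintegral_indicator hWm, lintegral_prod_symm _ (hFm.indicator hWm).aemeasurable]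
    refine lintegral_congr fun k => ?_
    rw [← lintegral_indicator (hVkm k)]
    refine lintegral_congr fun t => ?_
    by_cases ht : t ∈ Vk k
    · have hW' : (t, k) ∈ W := (hVk_mem k t).1 ht
      rw [indicator_of_mem ht, indicator_of_mem hW']
    · have hW' : (t, k) ∉ W := fun h => ht ((hVk_mem k t).2 h)
      rw [indicator_of_notMem ht, indicator_of_notMem hW']
  set J : ℝ≥0∞ := ∫⁻ p in W, F p ∂(tm₂.prod μK) with hJdef
  calc ν (Φ '' (A₀ ×ˢ V)) = c * (ν₂.prod μK) (Φ '' (A₀ ×ˢ V)) := by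
        rw [hνc, Measure.smul_apply, smul_eq_mul]
    _ = c * ∫⁻ k, ν₂ ((fun g : G₂ => (g, k)) ⁻¹' (Φ '' (A₀ ×ˢ V))) ∂μK := by rw [Measure.prod_apply_symm hS]
    _ = c * ∫⁻ k, ν₂ (Φ₂ '' (A₂ ×ˢ Vk k)) ∂μK := by simp_rw [hsec]
    _ = c * ∫⁻ k, quotientMeasure T₂ tm₂ hT₂c ν₂ A₂ * ∫⁻ t in Vk k, (D₂ ((t : ↥T₂) : G₂) : ℝ≥0∞) ∂tm₂ ∂μK := by
        congr 1
        exact lintegral_congr fun k => hJ₂ (Vk k) (hVkm k) (hVkU k) (hVkreg k) (hVkW k)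
    _ = c * quotientMeasure T₂ tm₂ hT₂c ν₂ A₂ * J := by
        rw [lintegral_const_mul' _ _ hA₂top, hTon, mul_assoc]
    _ = quotientMeasure (T₂.prod (⊤ : Subgroup K)) tm hTc ν A₀ * ∫⁻ s in V, (D s : ℝ≥0∞) ∂tm := by
        rw [hIV, ← hA₀key]
        ring

/-- **The same at a COMPACT `T₂`** (the letters of the compact-Cartan dock; `hT₂cpt.isClosed` feeds the general theorem). [cite: HarishChandra1970, Lemma 22]
[cite: Folland1995, §2.6 (2.52)] -/
theorem tubeJacobianLocal_prod_compact
    {T₂ : Subgroup G₂} (hT₂cpt : IsCompact (T₂ : Set G₂)) (hab₂ : ∀ a ∈ T₂, ∀ b ∈ T₂, a * b = b * a)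
    (hK : ∀ a b : K, a * b = b * a)
    (Φ₂ : (G₂ ⧸ T₂) × ↥T₂ → G₂) (hΦ₂ : ∀ (x : G₂) (t : ↥T₂), Φ₂ (QuotientGroup.mk x, t) = x * t * x⁻¹)
    [MeasurableSpace (G₂ ⧸ T₂)] [BorelSpace (G₂ ⧸ T₂)] (hT₂c : IsClosed (T₂ : Set G₂))
    (R₂ : G₂ → Prop) (D₂ : G₂ → ℝ≥0) (hD₂m : Measurable D₂)
    (hsock₂ : ∀ (ν₂ : Measure G₂) [ν₂.IsHaarMeasure] [ν₂.IsMulRightInvariant]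
      (tm₂ : Measure ↥T₂) [tm₂.IsMulLeftInvariant] [IsFiniteMeasureOnCompacts tm₂] [tm₂.IsOpenPosMeasure] [tm₂.IsInvInvariant],
      ∀ t₀ : ↥T₂, R₂ (t₀ : G₂) →
        ∃ U : Set ↥T₂, IsOpen U ∧ t₀ ∈ U ∧
          ∃ A₀ : Set (G₂ ⧸ T₂), MeasurableSet A₀ ∧ quotientMeasure T₂ tm₂ hT₂c ν₂ A₀ ≠ 0 ∧ quotientMeasure T₂ tm₂ hT₂c ν₂ A₀ ≠ ∞ ∧
            ∀ V : Set ↥T₂, MeasurableSet V → V ⊆ U → (∀ t ∈ V, R₂ ((t : ↥T₂) : G₂)) →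
              (∀ n : G₂, n ∉ T₂ → ∀ t ∈ V, ∀ t' ∈ V, ((t' : ↥T₂) : G₂) ≠ n * t * n⁻¹) →
                ν₂ (Φ₂ '' (A₀ ×ˢ V)) = quotientMeasure T₂ tm₂ hT₂c ν₂ A₀ * ∫⁻ t in V, (D₂ (t : G₂) : ℝ≥0∞) ∂tm₂)
    {T : Subgroup (G₂ × K)} (hT : T = T₂.prod ⊤) (hTc : IsClosed (T : Set (G₂ × K)))
    (Φ : ((G₂ × K) ⧸ T) × ↥T → G₂ × K) (hΦ : ∀ (x : G₂ × K) (t : ↥T), Φ (QuotientGroup.mk x, t) = x * t * x⁻¹)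
    [MeasurableSpace ((G₂ × K) ⧸ T)] [BorelSpace ((G₂ × K) ⧸ T)]
    (ν : Measure (G₂ × K)) [ν.IsHaarMeasure] [ν.IsMulRightInvariant]
    (tm : Measure ↥T) [tm.IsMulLeftInvariant] [IsFiniteMeasureOnCompacts tm] [tm.IsOpenPosMeasure] [tm.IsInvInvariant]
    (R : G₂ × K → Prop) (hR : ∀ p, R p → R₂ p.1)
    (D : ↥T → ℝ≥0) (hD : ∀ t : ↥T, D t = D₂ (t : G₂ × K).1) :
    ∀ t₀ : ↥T, R (t₀ : G₂ × K) →
      ∃ U : Set ↥T, IsOpen U ∧ t₀ ∈ U ∧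
        ∃ A₀ : Set ((G₂ × K) ⧸ T), MeasurableSet A₀ ∧ quotientMeasure T tm hTc ν A₀ ≠ 0 ∧ quotientMeasure T tm hTc ν A₀ ≠ ∞ ∧
          ∀ V : Set ↥T, MeasurableSet V → V ⊆ U → (∀ t ∈ V, R ((t : ↥T) : G₂ × K)) →
            (∀ n : G₂ × K, n ∉ T → ∀ t ∈ V, ∀ t' ∈ V, ((t' : ↥T) : G₂ × K) ≠ n * t * n⁻¹) →
              ν (Φ '' (A₀ ×ˢ V)) = quotientMeasure T tm hTc ν A₀ * ∫⁻ t in V, (D t : ℝ≥0∞) ∂tm :=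
  have _ := hT₂cpt
  tubeJacobianLocal_prod_compactFactor hab₂ hK Φ₂ hΦ₂ hT₂c R₂ D₂ hD₂m hsock₂ hT hTc Φ hΦ ν tm R hR D hD

end Socket

end Literature.MeasureTheory.Group

end
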